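import Summits.CriticalPhenomena.PercolationContinuityZ3.Theorems.PercNearOneGluingNoHeavyLowerTailSahiExchangeableLC
import Summits.CriticalPhenomena.PercolationContinuityZ3.Theorems.PercNearOneGluingNoHeavyLowerTailSahiPivotFamilyRefutation
import Mathlib
import HarnessLib
import HarnessLib.Audit.Tags

/-!
# `NoHeavyLowerTail` (crux stmt-CriticalPhenomena-4575), master-family line P1 (gen 19):
# EXMAX for the minimal mixed-payer system `S*` — one payer suffices for ALL nonnegative exchangeable weights (THEOREM)

Support file (seat `prim-masterthm-p1`, gen 19; `--supports stmt-CriticalPhenomena-4575`), on top of `…SahiExchangeableLC` (gen 17: `tripleWeight`,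
`wSideSum` = Φ_A/Φ_B, `wRainbowSum` = T) and `…SahiPivotFamilyRefutation` (gen 15: `lab3`, `lab3_mono`).  Memo
`run/shared/lean/prim/prim-masterthm/FROM-prim-masterthm-p1-g19-ULC-REFUTATION.md` §8; solves the "recommended exercise" of memo g16 §4.

`S*` = `BBB1B23A11111AAA` on `2^4` (`G₁ = ↑{0,1} ∪ ↑{3}`, `G₂ = ↑{0,2}`, `G₃ = ↑{1,2}`, core = pairwise intersections) is the unique (up to S₄) sunflower
labeling of `2^4` whose different fibres need different payers (memo g16 §4).  Writing `(d_j,a_j,b_j,g_j) = (w j 0, w j 1, w j 2, w j 3)`, its exchangeable-weight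
functionals are (`wRainbowSum_Sstar`, `wSideSumTop_Sstar`, `wSideSumBot_Sstar`)
  `T = 6[a₀a₁(b₂+g₂)a₃ + (a₀b₁+b₀a₁+b₀b₁)b₂a₃ + b₀b₁b₂d₃]`,
  `Φ_A − T = 6(b₂+g₂)·[b₃(a₀b₁+b₀a₁+b₀b₁) + a₃(b₀b₁ − a₀a₁)]`,   `Φ_B − T = 6(a₃+d₃)·[a₂(a₀a₁+a₀b₁+b₀a₁) + b₂(a₀a₁ − b₀b₁)]`,
so **`max(Φ_A, Φ_B) ≥ T` for ALL nonnegative weights** (`exmax_Sstar`): the payer is decided by the sign of `a₀a₁ − b₀b₁` (outside pays if `a₀a₁ ≥ b₀b₁`,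
core pays otherwise).  By the block calculus (memo g16 §3) this gives `PivotDichotomy` on the pure fibre of EVERY block composite `S*∘(c₀,c₁,c₂,c₃)` — the first
dichotomy theorem beyond uniform-payer bases (std3 / dual-std3).  (For general mixed-payer systems free-weight EXMAX is false — S5, memo g16 §9 — so this
is special to `S*`; the general statement must use the achievable-weight region, memo g19 §7.)
KERNEL TECHNIQUE: the three 4096-term sums are reduced to their supports (36 / 128+104 / 128+104 triples, enumerated by `decide`) and expanded.
HONEST FRAMING: one theorem about one 4-coordinate system; `PivotDichotomy 3`, S₃^max, CP3⁺ remain OPEN. [this work]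
-/

namespace Summit.CriticalPhenomena.PercolationContinuityZ3.Theorems

namespace SahiPivotFamily

open Finset AntipodalStrongHarris AntipodalStrongHarris.Lab

/-! ### 1. The system `S*` -/

/-- Generator of petal 1 (or core): `↑{0,1} ∪ ↑{3}`. [this work] -/
def sg1 (X : Finset ℕ) : Bool := (decide (0 ∈ X) && decide (1 ∈ X)) || decide (3 ∈ X)
/-- Generator of petal 2 (or core): `↑{0,2}`. [this work] -/
def sg2 (X : Finset ℕ) : Bool := decide (0 ∈ X) && decide (2 ∈ X)
/-- Generator of petal 3 (or core): `↑{1,2}`. [this work] -/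
def sg3 (X : Finset ℕ) : Bool := decide (1 ∈ X) && decide (2 ∈ X)

/-- **The minimal mixed-payer system `S*`** (`BBB1B23A11111AAA` on the subsets of `{0,1,2,3}`). [this work] -/
def Sstar (X : Finset ℕ) : Lab 3 := lab3 (sg1 X) (sg2 X) (sg3 X)

/-- `S*` is a sunflower labeling (monotone). [this work] -/
theorem Sstar_mono : ∀ ⦃X Y : Finset ℕ⦄, X ⊆ Y → Sstar X ≤ Sstar Y := by
  intro X Y hXY
  unfold Sstar
  have h : ∀ n : ℕ, decide (n ∈ X) = true → decide (n ∈ Y) = true := fun n hn => by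
    simp only [decide_eq_true_eq] at hn ⊢; exact hXY hn
  apply lab3_mono <;> simp only [sg1, sg2, sg3, Bool.and_eq_true, Bool.or_eq_true] <;> aesop

/-- The ground set. [this work] -/
def S4 : Finset ℕ := {0, 1, 2, 3}

/-- All triples of subsets. [this work] -/
def Q4 : Finset (Finset ℕ × Finset ℕ × Finset ℕ) := S4.powerset ×ˢ (S4.powerset ×ˢ S4.powerset)

/-! ### 2. The supports of the three sums (kernel enumeration) -/

/-- Rainbow triples of `S*`. [this work] -/
def supT : List (Finset ℕ × Finset ℕ × Finset ℕ) :=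
  [(({0, 1} : Finset ℕ), ({0, 2} : Finset ℕ), ({1, 2} : Finset ℕ)), (({0, 1} : Finset ℕ), ({1, 2} : Finset ℕ), ({0, 2} : Finset ℕ)), (({0, 2} : Finset ℕ), ({0, 1} : Finset ℕ), ({1, 2} : Finset ℕ)), (({0, 2} : Finset ℕ), ({1, 2} : Finset ℕ), ({0, 1} : Finset ℕ)),
    (({0, 2} : Finset ℕ), ({1, 2} : Finset ℕ), ({3} : Finset ℕ)), (({0, 2} : Finset ℕ), ({1, 2} : Finset ℕ), ({0, 3} : Finset ℕ)), (({0, 2} : Finset ℕ), ({1, 2} : Finset ℕ), ({1, 3} : Finset ℕ)), (({0, 2} : Finset ℕ), ({1, 2} : Finset ℕ), ({0, 1, 3} : Finset ℕ)),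
    (({0, 2} : Finset ℕ), ({1, 2} : Finset ℕ), ({2, 3} : Finset ℕ)), (({0, 2} : Finset ℕ), ({3} : Finset ℕ), ({1, 2} : Finset ℕ)), (({0, 2} : Finset ℕ), ({0, 3} : Finset ℕ), ({1, 2} : Finset ℕ)), (({0, 2} : Finset ℕ), ({1, 3} : Finset ℕ), ({1, 2} : Finset ℕ)),
    (({0, 2} : Finset ℕ), ({0, 1, 3} : Finset ℕ), ({1, 2} : Finset ℕ)), (({0, 2} : Finset ℕ), ({2, 3} : Finset ℕ), ({1, 2} : Finset ℕ)), (({1, 2} : Finset ℕ), ({0, 1} : Finset ℕ), ({0, 2} : Finset ℕ)), (({1, 2} : Finset ℕ), ({0, 2} : Finset ℕ), ({0, 1} : Finset ℕ)),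
    (({1, 2} : Finset ℕ), ({0, 2} : Finset ℕ), ({3} : Finset ℕ)), (({1, 2} : Finset ℕ), ({0, 2} : Finset ℕ), ({0, 3} : Finset ℕ)), (({1, 2} : Finset ℕ), ({0, 2} : Finset ℕ), ({1, 3} : Finset ℕ)), (({1, 2} : Finset ℕ), ({0, 2} : Finset ℕ), ({0, 1, 3} : Finset ℕ)),
    (({1, 2} : Finset ℕ), ({0, 2} : Finset ℕ), ({2, 3} : Finset ℕ)), (({1, 2} : Finset ℕ), ({3} : Finset ℕ), ({0, 2} : Finset ℕ)), (({1, 2} : Finset ℕ), ({0, 3} : Finset ℕ), ({0, 2} : Finset ℕ)), (({1, 2} : Finset ℕ), ({1, 3} : Finset ℕ), ({0, 2} : Finset ℕ)),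
    (({1, 2} : Finset ℕ), ({0, 1, 3} : Finset ℕ), ({0, 2} : Finset ℕ)), (({1, 2} : Finset ℕ), ({2, 3} : Finset ℕ), ({0, 2} : Finset ℕ)), (({3} : Finset ℕ), ({0, 2} : Finset ℕ), ({1, 2} : Finset ℕ)), (({3} : Finset ℕ), ({1, 2} : Finset ℕ), ({0, 2} : Finset ℕ)),
    (({0, 3} : Finset ℕ), ({0, 2} : Finset ℕ), ({1, 2} : Finset ℕ)), (({0, 3} : Finset ℕ), ({1, 2} : Finset ℕ), ({0, 2} : Finset ℕ)), (({1, 3} : Finset ℕ), ({0, 2} : Finset ℕ), ({1, 2} : Finset ℕ)), (({1, 3} : Finset ℕ), ({1, 2} : Finset ℕ), ({0, 2} : Finset ℕ)),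
    (({0, 1, 3} : Finset ℕ), ({0, 2} : Finset ℕ), ({1, 2} : Finset ℕ)), (({0, 1, 3} : Finset ℕ), ({1, 2} : Finset ℕ), ({0, 2} : Finset ℕ)), (({2, 3} : Finset ℕ), ({0, 2} : Finset ℕ), ({1, 2} : Finset ℕ)), (({2, 3} : Finset ℕ), ({1, 2} : Finset ℕ), ({0, 2} : Finset ℕ))]

/-- Core-pivot triples with `κ = +1`. [this work] -/
def supAp : List (Finset ℕ × Finset ℕ × Finset ℕ) :=
  [(({0, 1, 2} : Finset ℕ), (∅ : Finset ℕ), ({0, 1, 2} : Finset ℕ)), (({0, 1, 2} : Finset ℕ), (∅ : Finset ℕ), ({0, 2, 3} : Finset ℕ)), (({0, 1, 2} : Finset ℕ), (∅ : Finset ℕ), ({1, 2, 3} : Finset ℕ)), (({0, 1, 2} : Finset ℕ), (∅ : Finset ℕ), ({0, 1, 2, 3} : Finset ℕ)),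
    (({0, 1, 2} : Finset ℕ), ({0} : Finset ℕ), ({0, 1, 2} : Finset ℕ)), (({0, 1, 2} : Finset ℕ), ({0} : Finset ℕ), ({0, 2, 3} : Finset ℕ)), (({0, 1, 2} : Finset ℕ), ({0} : Finset ℕ), ({1, 2, 3} : Finset ℕ)), (({0, 1, 2} : Finset ℕ), ({0} : Finset ℕ), ({0, 1, 2, 3} : Finset ℕ)),
    (({0, 1, 2} : Finset ℕ), ({1} : Finset ℕ), ({0, 1, 2} : Finset ℕ)), (({0, 1, 2} : Finset ℕ), ({1} : Finset ℕ), ({0, 2, 3} : Finset ℕ)), (({0, 1, 2} : Finset ℕ), ({1} : Finset ℕ), ({1, 2, 3} : Finset ℕ)), (({0, 1, 2} : Finset ℕ), ({1} : Finset ℕ), ({0, 1, 2, 3} : Finset ℕ)),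
    (({0, 1, 2} : Finset ℕ), ({2} : Finset ℕ), ({0, 1, 2} : Finset ℕ)), (({0, 1, 2} : Finset ℕ), ({2} : Finset ℕ), ({0, 2, 3} : Finset ℕ)), (({0, 1, 2} : Finset ℕ), ({2} : Finset ℕ), ({1, 2, 3} : Finset ℕ)), (({0, 1, 2} : Finset ℕ), ({2} : Finset ℕ), ({0, 1, 2, 3} : Finset ℕ)),
    (({0, 1, 2} : Finset ℕ), ({0, 1, 2} : Finset ℕ), (∅ : Finset ℕ)), (({0, 1, 2} : Finset ℕ), ({0, 1, 2} : Finset ℕ), ({0} : Finset ℕ)), (({0, 1, 2} : Finset ℕ), ({0, 1, 2} : Finset ℕ), ({1} : Finset ℕ)), (({0, 1, 2} : Finset ℕ), ({0, 1, 2} : Finset ℕ), ({2} : Finset ℕ)),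
    (({0, 1, 2} : Finset ℕ), ({0, 2, 3} : Finset ℕ), (∅ : Finset ℕ)), (({0, 1, 2} : Finset ℕ), ({0, 2, 3} : Finset ℕ), ({0} : Finset ℕ)), (({0, 1, 2} : Finset ℕ), ({0, 2, 3} : Finset ℕ), ({1} : Finset ℕ)), (({0, 1, 2} : Finset ℕ), ({0, 2, 3} : Finset ℕ), ({2} : Finset ℕ)),
    (({0, 1, 2} : Finset ℕ), ({1, 2, 3} : Finset ℕ), (∅ : Finset ℕ)), (({0, 1, 2} : Finset ℕ), ({1, 2, 3} : Finset ℕ), ({0} : Finset ℕ)), (({0, 1, 2} : Finset ℕ), ({1, 2, 3} : Finset ℕ), ({1} : Finset ℕ)), (({0, 1, 2} : Finset ℕ), ({1, 2, 3} : Finset ℕ), ({2} : Finset ℕ)),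
    (({0, 1, 2} : Finset ℕ), ({0, 1, 2, 3} : Finset ℕ), (∅ : Finset ℕ)), (({0, 1, 2} : Finset ℕ), ({0, 1, 2, 3} : Finset ℕ), ({0} : Finset ℕ)), (({0, 1, 2} : Finset ℕ), ({0, 1, 2, 3} : Finset ℕ), ({1} : Finset ℕ)), (({0, 1, 2} : Finset ℕ), ({0, 1, 2, 3} : Finset ℕ), ({2} : Finset ℕ)),
    (({0, 2, 3} : Finset ℕ), (∅ : Finset ℕ), ({0, 1, 2} : Finset ℕ)), (({0, 2, 3} : Finset ℕ), (∅ : Finset ℕ), ({0, 2, 3} : Finset ℕ)), (({0, 2, 3} : Finset ℕ), (∅ : Finset ℕ), ({1, 2, 3} : Finset ℕ)), (({0, 2, 3} : Finset ℕ), (∅ : Finset ℕ), ({0, 1, 2, 3} : Finset ℕ)),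
    (({0, 2, 3} : Finset ℕ), ({0} : Finset ℕ), ({0, 1, 2} : Finset ℕ)), (({0, 2, 3} : Finset ℕ), ({0} : Finset ℕ), ({0, 2, 3} : Finset ℕ)), (({0, 2, 3} : Finset ℕ), ({0} : Finset ℕ), ({1, 2, 3} : Finset ℕ)), (({0, 2, 3} : Finset ℕ), ({0} : Finset ℕ), ({0, 1, 2, 3} : Finset ℕ)),
    (({0, 2, 3} : Finset ℕ), ({1} : Finset ℕ), ({0, 1, 2} : Finset ℕ)), (({0, 2, 3} : Finset ℕ), ({1} : Finset ℕ), ({0, 2, 3} : Finset ℕ)), (({0, 2, 3} : Finset ℕ), ({1} : Finset ℕ), ({1, 2, 3} : Finset ℕ)), (({0, 2, 3} : Finset ℕ), ({1} : Finset ℕ), ({0, 1, 2, 3} : Finset ℕ)),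
    (({0, 2, 3} : Finset ℕ), ({2} : Finset ℕ), ({0, 1, 2} : Finset ℕ)), (({0, 2, 3} : Finset ℕ), ({2} : Finset ℕ), ({0, 2, 3} : Finset ℕ)), (({0, 2, 3} : Finset ℕ), ({2} : Finset ℕ), ({1, 2, 3} : Finset ℕ)), (({0, 2, 3} : Finset ℕ), ({2} : Finset ℕ), ({0, 1, 2, 3} : Finset ℕ)),
    (({0, 2, 3} : Finset ℕ), ({0, 1, 2} : Finset ℕ), (∅ : Finset ℕ)), (({0, 2, 3} : Finset ℕ), ({0, 1, 2} : Finset ℕ), ({0} : Finset ℕ)), (({0, 2, 3} : Finset ℕ), ({0, 1, 2} : Finset ℕ), ({1} : Finset ℕ)), (({0, 2, 3} : Finset ℕ), ({0, 1, 2} : Finset ℕ), ({2} : Finset ℕ)),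
    (({0, 2, 3} : Finset ℕ), ({0, 2, 3} : Finset ℕ), (∅ : Finset ℕ)), (({0, 2, 3} : Finset ℕ), ({0, 2, 3} : Finset ℕ), ({0} : Finset ℕ)), (({0, 2, 3} : Finset ℕ), ({0, 2, 3} : Finset ℕ), ({1} : Finset ℕ)), (({0, 2, 3} : Finset ℕ), ({0, 2, 3} : Finset ℕ), ({2} : Finset ℕ)),
    (({0, 2, 3} : Finset ℕ), ({1, 2, 3} : Finset ℕ), (∅ : Finset ℕ)), (({0, 2, 3} : Finset ℕ), ({1, 2, 3} : Finset ℕ), ({0} : Finset ℕ)), (({0, 2, 3} : Finset ℕ), ({1, 2, 3} : Finset ℕ), ({1} : Finset ℕ)), (({0, 2, 3} : Finset ℕ), ({1, 2, 3} : Finset ℕ), ({2} : Finset ℕ)),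
    (({0, 2, 3} : Finset ℕ), ({0, 1, 2, 3} : Finset ℕ), (∅ : Finset ℕ)), (({0, 2, 3} : Finset ℕ), ({0, 1, 2, 3} : Finset ℕ), ({0} : Finset ℕ)), (({0, 2, 3} : Finset ℕ), ({0, 1, 2, 3} : Finset ℕ), ({1} : Finset ℕ)), (({0, 2, 3} : Finset ℕ), ({0, 1, 2, 3} : Finset ℕ), ({2} : Finset ℕ)),
    (({1, 2, 3} : Finset ℕ), (∅ : Finset ℕ), ({0, 1, 2} : Finset ℕ)), (({1, 2, 3} : Finset ℕ), (∅ : Finset ℕ), ({0, 2, 3} : Finset ℕ)), (({1, 2, 3} : Finset ℕ), (∅ : Finset ℕ), ({1, 2, 3} : Finset ℕ)), (({1, 2, 3} : Finset ℕ), (∅ : Finset ℕ), ({0, 1, 2, 3} : Finset ℕ)),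
    (({1, 2, 3} : Finset ℕ), ({0} : Finset ℕ), ({0, 1, 2} : Finset ℕ)), (({1, 2, 3} : Finset ℕ), ({0} : Finset ℕ), ({0, 2, 3} : Finset ℕ)), (({1, 2, 3} : Finset ℕ), ({0} : Finset ℕ), ({1, 2, 3} : Finset ℕ)), (({1, 2, 3} : Finset ℕ), ({0} : Finset ℕ), ({0, 1, 2, 3} : Finset ℕ)),
    (({1, 2, 3} : Finset ℕ), ({1} : Finset ℕ), ({0, 1, 2} : Finset ℕ)), (({1, 2, 3} : Finset ℕ), ({1} : Finset ℕ), ({0, 2, 3} : Finset ℕ)), (({1, 2, 3} : Finset ℕ), ({1} : Finset ℕ), ({1, 2, 3} : Finset ℕ)), (({1, 2, 3} : Finset ℕ), ({1} : Finset ℕ), ({0, 1, 2, 3} : Finset ℕ)),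
    (({1, 2, 3} : Finset ℕ), ({2} : Finset ℕ), ({0, 1, 2} : Finset ℕ)), (({1, 2, 3} : Finset ℕ), ({2} : Finset ℕ), ({0, 2, 3} : Finset ℕ)), (({1, 2, 3} : Finset ℕ), ({2} : Finset ℕ), ({1, 2, 3} : Finset ℕ)), (({1, 2, 3} : Finset ℕ), ({2} : Finset ℕ), ({0, 1, 2, 3} : Finset ℕ)),
    (({1, 2, 3} : Finset ℕ), ({0, 1, 2} : Finset ℕ), (∅ : Finset ℕ)), (({1, 2, 3} : Finset ℕ), ({0, 1, 2} : Finset ℕ), ({0} : Finset ℕ)), (({1, 2, 3} : Finset ℕ), ({0, 1, 2} : Finset ℕ), ({1} : Finset ℕ)), (({1, 2, 3} : Finset ℕ), ({0, 1, 2} : Finset ℕ), ({2} : Finset ℕ)),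
    (({1, 2, 3} : Finset ℕ), ({0, 2, 3} : Finset ℕ), (∅ : Finset ℕ)), (({1, 2, 3} : Finset ℕ), ({0, 2, 3} : Finset ℕ), ({0} : Finset ℕ)), (({1, 2, 3} : Finset ℕ), ({0, 2, 3} : Finset ℕ), ({1} : Finset ℕ)), (({1, 2, 3} : Finset ℕ), ({0, 2, 3} : Finset ℕ), ({2} : Finset ℕ)),
    (({1, 2, 3} : Finset ℕ), ({1, 2, 3} : Finset ℕ), (∅ : Finset ℕ)), (({1, 2, 3} : Finset ℕ), ({1, 2, 3} : Finset ℕ), ({0} : Finset ℕ)), (({1, 2, 3} : Finset ℕ), ({1, 2, 3} : Finset ℕ), ({1} : Finset ℕ)), (({1, 2, 3} : Finset ℕ), ({1, 2, 3} : Finset ℕ), ({2} : Finset ℕ)),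
    (({1, 2, 3} : Finset ℕ), ({0, 1, 2, 3} : Finset ℕ), (∅ : Finset ℕ)), (({1, 2, 3} : Finset ℕ), ({0, 1, 2, 3} : Finset ℕ), ({0} : Finset ℕ)), (({1, 2, 3} : Finset ℕ), ({0, 1, 2, 3} : Finset ℕ), ({1} : Finset ℕ)), (({1, 2, 3} : Finset ℕ), ({0, 1, 2, 3} : Finset ℕ), ({2} : Finset ℕ)),
    (({0, 1, 2, 3} : Finset ℕ), (∅ : Finset ℕ), ({0, 1, 2} : Finset ℕ)), (({0, 1, 2, 3} : Finset ℕ), (∅ : Finset ℕ), ({0, 2, 3} : Finset ℕ)), (({0, 1, 2, 3} : Finset ℕ), (∅ : Finset ℕ), ({1, 2, 3} : Finset ℕ)), (({0, 1, 2, 3} : Finset ℕ), (∅ : Finset ℕ), ({0, 1, 2, 3} : Finset ℕ)),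
    (({0, 1, 2, 3} : Finset ℕ), ({0} : Finset ℕ), ({0, 1, 2} : Finset ℕ)), (({0, 1, 2, 3} : Finset ℕ), ({0} : Finset ℕ), ({0, 2, 3} : Finset ℕ)), (({0, 1, 2, 3} : Finset ℕ), ({0} : Finset ℕ), ({1, 2, 3} : Finset ℕ)), (({0, 1, 2, 3} : Finset ℕ), ({0} : Finset ℕ), ({0, 1, 2, 3} : Finset ℕ)),
    (({0, 1, 2, 3} : Finset ℕ), ({1} : Finset ℕ), ({0, 1, 2} : Finset ℕ)), (({0, 1, 2, 3} : Finset ℕ), ({1} : Finset ℕ), ({0, 2, 3} : Finset ℕ)), (({0, 1, 2, 3} : Finset ℕ), ({1} : Finset ℕ), ({1, 2, 3} : Finset ℕ)), (({0, 1, 2, 3} : Finset ℕ), ({1} : Finset ℕ), ({0, 1, 2, 3} : Finset ℕ)),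
    (({0, 1, 2, 3} : Finset ℕ), ({2} : Finset ℕ), ({0, 1, 2} : Finset ℕ)), (({0, 1, 2, 3} : Finset ℕ), ({2} : Finset ℕ), ({0, 2, 3} : Finset ℕ)), (({0, 1, 2, 3} : Finset ℕ), ({2} : Finset ℕ), ({1, 2, 3} : Finset ℕ)), (({0, 1, 2, 3} : Finset ℕ), ({2} : Finset ℕ), ({0, 1, 2, 3} : Finset ℕ)),
    (({0, 1, 2, 3} : Finset ℕ), ({0, 1, 2} : Finset ℕ), (∅ : Finset ℕ)), (({0, 1, 2, 3} : Finset ℕ), ({0, 1, 2} : Finset ℕ), ({0} : Finset ℕ)), (({0, 1, 2, 3} : Finset ℕ), ({0, 1, 2} : Finset ℕ), ({1} : Finset ℕ)), (({0, 1, 2, 3} : Finset ℕ), ({0, 1, 2} : Finset ℕ), ({2} : Finset ℕ)),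
    (({0, 1, 2, 3} : Finset ℕ), ({0, 2, 3} : Finset ℕ), (∅ : Finset ℕ)), (({0, 1, 2, 3} : Finset ℕ), ({0, 2, 3} : Finset ℕ), ({0} : Finset ℕ)), (({0, 1, 2, 3} : Finset ℕ), ({0, 2, 3} : Finset ℕ), ({1} : Finset ℕ)), (({0, 1, 2, 3} : Finset ℕ), ({0, 2, 3} : Finset ℕ), ({2} : Finset ℕ)),
    (({0, 1, 2, 3} : Finset ℕ), ({1, 2, 3} : Finset ℕ), (∅ : Finset ℕ)), (({0, 1, 2, 3} : Finset ℕ), ({1, 2, 3} : Finset ℕ), ({0} : Finset ℕ)), (({0, 1, 2, 3} : Finset ℕ), ({1, 2, 3} : Finset ℕ), ({1} : Finset ℕ)), (({0, 1, 2, 3} : Finset ℕ), ({1, 2, 3} : Finset ℕ), ({2} : Finset ℕ)),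
    (({0, 1, 2, 3} : Finset ℕ), ({0, 1, 2, 3} : Finset ℕ), (∅ : Finset ℕ)), (({0, 1, 2, 3} : Finset ℕ), ({0, 1, 2, 3} : Finset ℕ), ({0} : Finset ℕ)), (({0, 1, 2, 3} : Finset ℕ), ({0, 1, 2, 3} : Finset ℕ), ({1} : Finset ℕ)), (({0, 1, 2, 3} : Finset ℕ), ({0, 1, 2, 3} : Finset ℕ), ({2} : Finset ℕ))]

/-- Core-pivot triples with `κ = −1`. [this work] -/
def supAm : List (Finset ℕ × Finset ℕ × Finset ℕ) :=
  [(({0, 1, 2} : Finset ℕ), ({0, 1} : Finset ℕ), ({0, 2} : Finset ℕ)), (({0, 1, 2} : Finset ℕ), ({0, 1} : Finset ℕ), ({1, 2} : Finset ℕ)), (({0, 1, 2} : Finset ℕ), ({0, 2} : Finset ℕ), ({0, 1} : Finset ℕ)), (({0, 1, 2} : Finset ℕ), ({0, 2} : Finset ℕ), ({1, 2} : Finset ℕ)),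
    (({0, 1, 2} : Finset ℕ), ({0, 2} : Finset ℕ), ({3} : Finset ℕ)), (({0, 1, 2} : Finset ℕ), ({0, 2} : Finset ℕ), ({0, 3} : Finset ℕ)), (({0, 1, 2} : Finset ℕ), ({0, 2} : Finset ℕ), ({1, 3} : Finset ℕ)), (({0, 1, 2} : Finset ℕ), ({0, 2} : Finset ℕ), ({0, 1, 3} : Finset ℕ)),
    (({0, 1, 2} : Finset ℕ), ({0, 2} : Finset ℕ), ({2, 3} : Finset ℕ)), (({0, 1, 2} : Finset ℕ), ({1, 2} : Finset ℕ), ({0, 1} : Finset ℕ)), (({0, 1, 2} : Finset ℕ), ({1, 2} : Finset ℕ), ({0, 2} : Finset ℕ)), (({0, 1, 2} : Finset ℕ), ({1, 2} : Finset ℕ), ({3} : Finset ℕ)),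
    (({0, 1, 2} : Finset ℕ), ({1, 2} : Finset ℕ), ({0, 3} : Finset ℕ)), (({0, 1, 2} : Finset ℕ), ({1, 2} : Finset ℕ), ({1, 3} : Finset ℕ)), (({0, 1, 2} : Finset ℕ), ({1, 2} : Finset ℕ), ({0, 1, 3} : Finset ℕ)), (({0, 1, 2} : Finset ℕ), ({1, 2} : Finset ℕ), ({2, 3} : Finset ℕ)),
    (({0, 1, 2} : Finset ℕ), ({3} : Finset ℕ), ({0, 2} : Finset ℕ)), (({0, 1, 2} : Finset ℕ), ({3} : Finset ℕ), ({1, 2} : Finset ℕ)), (({0, 1, 2} : Finset ℕ), ({0, 3} : Finset ℕ), ({0, 2} : Finset ℕ)), (({0, 1, 2} : Finset ℕ), ({0, 3} : Finset ℕ), ({1, 2} : Finset ℕ)),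
    (({0, 1, 2} : Finset ℕ), ({1, 3} : Finset ℕ), ({0, 2} : Finset ℕ)), (({0, 1, 2} : Finset ℕ), ({1, 3} : Finset ℕ), ({1, 2} : Finset ℕ)), (({0, 1, 2} : Finset ℕ), ({0, 1, 3} : Finset ℕ), ({0, 2} : Finset ℕ)), (({0, 1, 2} : Finset ℕ), ({0, 1, 3} : Finset ℕ), ({1, 2} : Finset ℕ)),
    (({0, 1, 2} : Finset ℕ), ({2, 3} : Finset ℕ), ({0, 2} : Finset ℕ)), (({0, 1, 2} : Finset ℕ), ({2, 3} : Finset ℕ), ({1, 2} : Finset ℕ)), (({0, 2, 3} : Finset ℕ), ({0, 1} : Finset ℕ), ({0, 2} : Finset ℕ)), (({0, 2, 3} : Finset ℕ), ({0, 1} : Finset ℕ), ({1, 2} : Finset ℕ)),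
    (({0, 2, 3} : Finset ℕ), ({0, 2} : Finset ℕ), ({0, 1} : Finset ℕ)), (({0, 2, 3} : Finset ℕ), ({0, 2} : Finset ℕ), ({1, 2} : Finset ℕ)), (({0, 2, 3} : Finset ℕ), ({0, 2} : Finset ℕ), ({3} : Finset ℕ)), (({0, 2, 3} : Finset ℕ), ({0, 2} : Finset ℕ), ({0, 3} : Finset ℕ)),
    (({0, 2, 3} : Finset ℕ), ({0, 2} : Finset ℕ), ({1, 3} : Finset ℕ)), (({0, 2, 3} : Finset ℕ), ({0, 2} : Finset ℕ), ({0, 1, 3} : Finset ℕ)), (({0, 2, 3} : Finset ℕ), ({0, 2} : Finset ℕ), ({2, 3} : Finset ℕ)), (({0, 2, 3} : Finset ℕ), ({1, 2} : Finset ℕ), ({0, 1} : Finset ℕ)),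
    (({0, 2, 3} : Finset ℕ), ({1, 2} : Finset ℕ), ({0, 2} : Finset ℕ)), (({0, 2, 3} : Finset ℕ), ({1, 2} : Finset ℕ), ({3} : Finset ℕ)), (({0, 2, 3} : Finset ℕ), ({1, 2} : Finset ℕ), ({0, 3} : Finset ℕ)), (({0, 2, 3} : Finset ℕ), ({1, 2} : Finset ℕ), ({1, 3} : Finset ℕ)),
    (({0, 2, 3} : Finset ℕ), ({1, 2} : Finset ℕ), ({0, 1, 3} : Finset ℕ)), (({0, 2, 3} : Finset ℕ), ({1, 2} : Finset ℕ), ({2, 3} : Finset ℕ)), (({0, 2, 3} : Finset ℕ), ({3} : Finset ℕ), ({0, 2} : Finset ℕ)), (({0, 2, 3} : Finset ℕ), ({3} : Finset ℕ), ({1, 2} : Finset ℕ)),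
    (({0, 2, 3} : Finset ℕ), ({0, 3} : Finset ℕ), ({0, 2} : Finset ℕ)), (({0, 2, 3} : Finset ℕ), ({0, 3} : Finset ℕ), ({1, 2} : Finset ℕ)), (({0, 2, 3} : Finset ℕ), ({1, 3} : Finset ℕ), ({0, 2} : Finset ℕ)), (({0, 2, 3} : Finset ℕ), ({1, 3} : Finset ℕ), ({1, 2} : Finset ℕ)),
    (({0, 2, 3} : Finset ℕ), ({0, 1, 3} : Finset ℕ), ({0, 2} : Finset ℕ)), (({0, 2, 3} : Finset ℕ), ({0, 1, 3} : Finset ℕ), ({1, 2} : Finset ℕ)), (({0, 2, 3} : Finset ℕ), ({2, 3} : Finset ℕ), ({0, 2} : Finset ℕ)), (({0, 2, 3} : Finset ℕ), ({2, 3} : Finset ℕ), ({1, 2} : Finset ℕ)),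
    (({1, 2, 3} : Finset ℕ), ({0, 1} : Finset ℕ), ({0, 2} : Finset ℕ)), (({1, 2, 3} : Finset ℕ), ({0, 1} : Finset ℕ), ({1, 2} : Finset ℕ)), (({1, 2, 3} : Finset ℕ), ({0, 2} : Finset ℕ), ({0, 1} : Finset ℕ)), (({1, 2, 3} : Finset ℕ), ({0, 2} : Finset ℕ), ({1, 2} : Finset ℕ)),
    (({1, 2, 3} : Finset ℕ), ({0, 2} : Finset ℕ), ({3} : Finset ℕ)), (({1, 2, 3} : Finset ℕ), ({0, 2} : Finset ℕ), ({0, 3} : Finset ℕ)), (({1, 2, 3} : Finset ℕ), ({0, 2} : Finset ℕ), ({1, 3} : Finset ℕ)), (({1, 2, 3} : Finset ℕ), ({0, 2} : Finset ℕ), ({0, 1, 3} : Finset ℕ)),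
    (({1, 2, 3} : Finset ℕ), ({0, 2} : Finset ℕ), ({2, 3} : Finset ℕ)), (({1, 2, 3} : Finset ℕ), ({1, 2} : Finset ℕ), ({0, 1} : Finset ℕ)), (({1, 2, 3} : Finset ℕ), ({1, 2} : Finset ℕ), ({0, 2} : Finset ℕ)), (({1, 2, 3} : Finset ℕ), ({1, 2} : Finset ℕ), ({3} : Finset ℕ)),
    (({1, 2, 3} : Finset ℕ), ({1, 2} : Finset ℕ), ({0, 3} : Finset ℕ)), (({1, 2, 3} : Finset ℕ), ({1, 2} : Finset ℕ), ({1, 3} : Finset ℕ)), (({1, 2, 3} : Finset ℕ), ({1, 2} : Finset ℕ), ({0, 1, 3} : Finset ℕ)), (({1, 2, 3} : Finset ℕ), ({1, 2} : Finset ℕ), ({2, 3} : Finset ℕ)),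
    (({1, 2, 3} : Finset ℕ), ({3} : Finset ℕ), ({0, 2} : Finset ℕ)), (({1, 2, 3} : Finset ℕ), ({3} : Finset ℕ), ({1, 2} : Finset ℕ)), (({1, 2, 3} : Finset ℕ), ({0, 3} : Finset ℕ), ({0, 2} : Finset ℕ)), (({1, 2, 3} : Finset ℕ), ({0, 3} : Finset ℕ), ({1, 2} : Finset ℕ)),
    (({1, 2, 3} : Finset ℕ), ({1, 3} : Finset ℕ), ({0, 2} : Finset ℕ)), (({1, 2, 3} : Finset ℕ), ({1, 3} : Finset ℕ), ({1, 2} : Finset ℕ)), (({1, 2, 3} : Finset ℕ), ({0, 1, 3} : Finset ℕ), ({0, 2} : Finset ℕ)), (({1, 2, 3} : Finset ℕ), ({0, 1, 3} : Finset ℕ), ({1, 2} : Finset ℕ)),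
    (({1, 2, 3} : Finset ℕ), ({2, 3} : Finset ℕ), ({0, 2} : Finset ℕ)), (({1, 2, 3} : Finset ℕ), ({2, 3} : Finset ℕ), ({1, 2} : Finset ℕ)), (({0, 1, 2, 3} : Finset ℕ), ({0, 1} : Finset ℕ), ({0, 2} : Finset ℕ)), (({0, 1, 2, 3} : Finset ℕ), ({0, 1} : Finset ℕ), ({1, 2} : Finset ℕ)),
    (({0, 1, 2, 3} : Finset ℕ), ({0, 2} : Finset ℕ), ({0, 1} : Finset ℕ)), (({0, 1, 2, 3} : Finset ℕ), ({0, 2} : Finset ℕ), ({1, 2} : Finset ℕ)), (({0, 1, 2, 3} : Finset ℕ), ({0, 2} : Finset ℕ), ({3} : Finset ℕ)), (({0, 1, 2, 3} : Finset ℕ), ({0, 2} : Finset ℕ), ({0, 3} : Finset ℕ)),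
    (({0, 1, 2, 3} : Finset ℕ), ({0, 2} : Finset ℕ), ({1, 3} : Finset ℕ)), (({0, 1, 2, 3} : Finset ℕ), ({0, 2} : Finset ℕ), ({0, 1, 3} : Finset ℕ)), (({0, 1, 2, 3} : Finset ℕ), ({0, 2} : Finset ℕ), ({2, 3} : Finset ℕ)), (({0, 1, 2, 3} : Finset ℕ), ({1, 2} : Finset ℕ), ({0, 1} : Finset ℕ)),
    (({0, 1, 2, 3} : Finset ℕ), ({1, 2} : Finset ℕ), ({0, 2} : Finset ℕ)), (({0, 1, 2, 3} : Finset ℕ), ({1, 2} : Finset ℕ), ({3} : Finset ℕ)), (({0, 1, 2, 3} : Finset ℕ), ({1, 2} : Finset ℕ), ({0, 3} : Finset ℕ)), (({0, 1, 2, 3} : Finset ℕ), ({1, 2} : Finset ℕ), ({1, 3} : Finset ℕ)),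
    (({0, 1, 2, 3} : Finset ℕ), ({1, 2} : Finset ℕ), ({0, 1, 3} : Finset ℕ)), (({0, 1, 2, 3} : Finset ℕ), ({1, 2} : Finset ℕ), ({2, 3} : Finset ℕ)), (({0, 1, 2, 3} : Finset ℕ), ({3} : Finset ℕ), ({0, 2} : Finset ℕ)), (({0, 1, 2, 3} : Finset ℕ), ({3} : Finset ℕ), ({1, 2} : Finset ℕ)),
    (({0, 1, 2, 3} : Finset ℕ), ({0, 3} : Finset ℕ), ({0, 2} : Finset ℕ)), (({0, 1, 2, 3} : Finset ℕ), ({0, 3} : Finset ℕ), ({1, 2} : Finset ℕ)), (({0, 1, 2, 3} : Finset ℕ), ({1, 3} : Finset ℕ), ({0, 2} : Finset ℕ)), (({0, 1, 2, 3} : Finset ℕ), ({1, 3} : Finset ℕ), ({1, 2} : Finset ℕ)),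
    (({0, 1, 2, 3} : Finset ℕ), ({0, 1, 3} : Finset ℕ), ({0, 2} : Finset ℕ)), (({0, 1, 2, 3} : Finset ℕ), ({0, 1, 3} : Finset ℕ), ({1, 2} : Finset ℕ)), (({0, 1, 2, 3} : Finset ℕ), ({2, 3} : Finset ℕ), ({0, 2} : Finset ℕ)), (({0, 1, 2, 3} : Finset ℕ), ({2, 3} : Finset ℕ), ({1, 2} : Finset ℕ))]

/-- Outside-pivot triples with `κ = +1`. [this work] -/
def supBp : List (Finset ℕ × Finset ℕ × Finset ℕ) :=
  [((∅ : Finset ℕ), (∅ : Finset ℕ), ({0, 1, 2} : Finset ℕ)), ((∅ : Finset ℕ), (∅ : Finset ℕ), ({0, 2, 3} : Finset ℕ)), ((∅ : Finset ℕ), (∅ : Finset ℕ), ({1, 2, 3} : Finset ℕ)), ((∅ : Finset ℕ), (∅ : Finset ℕ), ({0, 1, 2, 3} : Finset ℕ)),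
    ((∅ : Finset ℕ), ({0} : Finset ℕ), ({0, 1, 2} : Finset ℕ)), ((∅ : Finset ℕ), ({0} : Finset ℕ), ({0, 2, 3} : Finset ℕ)), ((∅ : Finset ℕ), ({0} : Finset ℕ), ({1, 2, 3} : Finset ℕ)), ((∅ : Finset ℕ), ({0} : Finset ℕ), ({0, 1, 2, 3} : Finset ℕ)),
    ((∅ : Finset ℕ), ({1} : Finset ℕ), ({0, 1, 2} : Finset ℕ)), ((∅ : Finset ℕ), ({1} : Finset ℕ), ({0, 2, 3} : Finset ℕ)), ((∅ : Finset ℕ), ({1} : Finset ℕ), ({1, 2, 3} : Finset ℕ)), ((∅ : Finset ℕ), ({1} : Finset ℕ), ({0, 1, 2, 3} : Finset ℕ)),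
    ((∅ : Finset ℕ), ({2} : Finset ℕ), ({0, 1, 2} : Finset ℕ)), ((∅ : Finset ℕ), ({2} : Finset ℕ), ({0, 2, 3} : Finset ℕ)), ((∅ : Finset ℕ), ({2} : Finset ℕ), ({1, 2, 3} : Finset ℕ)), ((∅ : Finset ℕ), ({2} : Finset ℕ), ({0, 1, 2, 3} : Finset ℕ)),
    ((∅ : Finset ℕ), ({0, 1, 2} : Finset ℕ), (∅ : Finset ℕ)), ((∅ : Finset ℕ), ({0, 1, 2} : Finset ℕ), ({0} : Finset ℕ)), ((∅ : Finset ℕ), ({0, 1, 2} : Finset ℕ), ({1} : Finset ℕ)), ((∅ : Finset ℕ), ({0, 1, 2} : Finset ℕ), ({2} : Finset ℕ)),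
    ((∅ : Finset ℕ), ({0, 2, 3} : Finset ℕ), (∅ : Finset ℕ)), ((∅ : Finset ℕ), ({0, 2, 3} : Finset ℕ), ({0} : Finset ℕ)), ((∅ : Finset ℕ), ({0, 2, 3} : Finset ℕ), ({1} : Finset ℕ)), ((∅ : Finset ℕ), ({0, 2, 3} : Finset ℕ), ({2} : Finset ℕ)),
    ((∅ : Finset ℕ), ({1, 2, 3} : Finset ℕ), (∅ : Finset ℕ)), ((∅ : Finset ℕ), ({1, 2, 3} : Finset ℕ), ({0} : Finset ℕ)), ((∅ : Finset ℕ), ({1, 2, 3} : Finset ℕ), ({1} : Finset ℕ)), ((∅ : Finset ℕ), ({1, 2, 3} : Finset ℕ), ({2} : Finset ℕ)),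
    ((∅ : Finset ℕ), ({0, 1, 2, 3} : Finset ℕ), (∅ : Finset ℕ)), ((∅ : Finset ℕ), ({0, 1, 2, 3} : Finset ℕ), ({0} : Finset ℕ)), ((∅ : Finset ℕ), ({0, 1, 2, 3} : Finset ℕ), ({1} : Finset ℕ)), ((∅ : Finset ℕ), ({0, 1, 2, 3} : Finset ℕ), ({2} : Finset ℕ)),
    (({0} : Finset ℕ), (∅ : Finset ℕ), ({0, 1, 2} : Finset ℕ)), (({0} : Finset ℕ), (∅ : Finset ℕ), ({0, 2, 3} : Finset ℕ)), (({0} : Finset ℕ), (∅ : Finset ℕ), ({1, 2, 3} : Finset ℕ)), (({0} : Finset ℕ), (∅ : Finset ℕ), ({0, 1, 2, 3} : Finset ℕ)),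
    (({0} : Finset ℕ), ({0} : Finset ℕ), ({0, 1, 2} : Finset ℕ)), (({0} : Finset ℕ), ({0} : Finset ℕ), ({0, 2, 3} : Finset ℕ)), (({0} : Finset ℕ), ({0} : Finset ℕ), ({1, 2, 3} : Finset ℕ)), (({0} : Finset ℕ), ({0} : Finset ℕ), ({0, 1, 2, 3} : Finset ℕ)),
    (({0} : Finset ℕ), ({1} : Finset ℕ), ({0, 1, 2} : Finset ℕ)), (({0} : Finset ℕ), ({1} : Finset ℕ), ({0, 2, 3} : Finset ℕ)), (({0} : Finset ℕ), ({1} : Finset ℕ), ({1, 2, 3} : Finset ℕ)), (({0} : Finset ℕ), ({1} : Finset ℕ), ({0, 1, 2, 3} : Finset ℕ)),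
    (({0} : Finset ℕ), ({2} : Finset ℕ), ({0, 1, 2} : Finset ℕ)), (({0} : Finset ℕ), ({2} : Finset ℕ), ({0, 2, 3} : Finset ℕ)), (({0} : Finset ℕ), ({2} : Finset ℕ), ({1, 2, 3} : Finset ℕ)), (({0} : Finset ℕ), ({2} : Finset ℕ), ({0, 1, 2, 3} : Finset ℕ)),
    (({0} : Finset ℕ), ({0, 1, 2} : Finset ℕ), (∅ : Finset ℕ)), (({0} : Finset ℕ), ({0, 1, 2} : Finset ℕ), ({0} : Finset ℕ)), (({0} : Finset ℕ), ({0, 1, 2} : Finset ℕ), ({1} : Finset ℕ)), (({0} : Finset ℕ), ({0, 1, 2} : Finset ℕ), ({2} : Finset ℕ)),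
    (({0} : Finset ℕ), ({0, 2, 3} : Finset ℕ), (∅ : Finset ℕ)), (({0} : Finset ℕ), ({0, 2, 3} : Finset ℕ), ({0} : Finset ℕ)), (({0} : Finset ℕ), ({0, 2, 3} : Finset ℕ), ({1} : Finset ℕ)), (({0} : Finset ℕ), ({0, 2, 3} : Finset ℕ), ({2} : Finset ℕ)),
    (({0} : Finset ℕ), ({1, 2, 3} : Finset ℕ), (∅ : Finset ℕ)), (({0} : Finset ℕ), ({1, 2, 3} : Finset ℕ), ({0} : Finset ℕ)), (({0} : Finset ℕ), ({1, 2, 3} : Finset ℕ), ({1} : Finset ℕ)), (({0} : Finset ℕ), ({1, 2, 3} : Finset ℕ), ({2} : Finset ℕ)),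
    (({0} : Finset ℕ), ({0, 1, 2, 3} : Finset ℕ), (∅ : Finset ℕ)), (({0} : Finset ℕ), ({0, 1, 2, 3} : Finset ℕ), ({0} : Finset ℕ)), (({0} : Finset ℕ), ({0, 1, 2, 3} : Finset ℕ), ({1} : Finset ℕ)), (({0} : Finset ℕ), ({0, 1, 2, 3} : Finset ℕ), ({2} : Finset ℕ)),
    (({1} : Finset ℕ), (∅ : Finset ℕ), ({0, 1, 2} : Finset ℕ)), (({1} : Finset ℕ), (∅ : Finset ℕ), ({0, 2, 3} : Finset ℕ)), (({1} : Finset ℕ), (∅ : Finset ℕ), ({1, 2, 3} : Finset ℕ)), (({1} : Finset ℕ), (∅ : Finset ℕ), ({0, 1, 2, 3} : Finset ℕ)),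
    (({1} : Finset ℕ), ({0} : Finset ℕ), ({0, 1, 2} : Finset ℕ)), (({1} : Finset ℕ), ({0} : Finset ℕ), ({0, 2, 3} : Finset ℕ)), (({1} : Finset ℕ), ({0} : Finset ℕ), ({1, 2, 3} : Finset ℕ)), (({1} : Finset ℕ), ({0} : Finset ℕ), ({0, 1, 2, 3} : Finset ℕ)),
    (({1} : Finset ℕ), ({1} : Finset ℕ), ({0, 1, 2} : Finset ℕ)), (({1} : Finset ℕ), ({1} : Finset ℕ), ({0, 2, 3} : Finset ℕ)), (({1} : Finset ℕ), ({1} : Finset ℕ), ({1, 2, 3} : Finset ℕ)), (({1} : Finset ℕ), ({1} : Finset ℕ), ({0, 1, 2, 3} : Finset ℕ)),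
    (({1} : Finset ℕ), ({2} : Finset ℕ), ({0, 1, 2} : Finset ℕ)), (({1} : Finset ℕ), ({2} : Finset ℕ), ({0, 2, 3} : Finset ℕ)), (({1} : Finset ℕ), ({2} : Finset ℕ), ({1, 2, 3} : Finset ℕ)), (({1} : Finset ℕ), ({2} : Finset ℕ), ({0, 1, 2, 3} : Finset ℕ)),
    (({1} : Finset ℕ), ({0, 1, 2} : Finset ℕ), (∅ : Finset ℕ)), (({1} : Finset ℕ), ({0, 1, 2} : Finset ℕ), ({0} : Finset ℕ)), (({1} : Finset ℕ), ({0, 1, 2} : Finset ℕ), ({1} : Finset ℕ)), (({1} : Finset ℕ), ({0, 1, 2} : Finset ℕ), ({2} : Finset ℕ)),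
    (({1} : Finset ℕ), ({0, 2, 3} : Finset ℕ), (∅ : Finset ℕ)), (({1} : Finset ℕ), ({0, 2, 3} : Finset ℕ), ({0} : Finset ℕ)), (({1} : Finset ℕ), ({0, 2, 3} : Finset ℕ), ({1} : Finset ℕ)), (({1} : Finset ℕ), ({0, 2, 3} : Finset ℕ), ({2} : Finset ℕ)),
    (({1} : Finset ℕ), ({1, 2, 3} : Finset ℕ), (∅ : Finset ℕ)), (({1} : Finset ℕ), ({1, 2, 3} : Finset ℕ), ({0} : Finset ℕ)), (({1} : Finset ℕ), ({1, 2, 3} : Finset ℕ), ({1} : Finset ℕ)), (({1} : Finset ℕ), ({1, 2, 3} : Finset ℕ), ({2} : Finset ℕ)),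
    (({1} : Finset ℕ), ({0, 1, 2, 3} : Finset ℕ), (∅ : Finset ℕ)), (({1} : Finset ℕ), ({0, 1, 2, 3} : Finset ℕ), ({0} : Finset ℕ)), (({1} : Finset ℕ), ({0, 1, 2, 3} : Finset ℕ), ({1} : Finset ℕ)), (({1} : Finset ℕ), ({0, 1, 2, 3} : Finset ℕ), ({2} : Finset ℕ)),
    (({2} : Finset ℕ), (∅ : Finset ℕ), ({0, 1, 2} : Finset ℕ)), (({2} : Finset ℕ), (∅ : Finset ℕ), ({0, 2, 3} : Finset ℕ)), (({2} : Finset ℕ), (∅ : Finset ℕ), ({1, 2, 3} : Finset ℕ)), (({2} : Finset ℕ), (∅ : Finset ℕ), ({0, 1, 2, 3} : Finset ℕ)),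
    (({2} : Finset ℕ), ({0} : Finset ℕ), ({0, 1, 2} : Finset ℕ)), (({2} : Finset ℕ), ({0} : Finset ℕ), ({0, 2, 3} : Finset ℕ)), (({2} : Finset ℕ), ({0} : Finset ℕ), ({1, 2, 3} : Finset ℕ)), (({2} : Finset ℕ), ({0} : Finset ℕ), ({0, 1, 2, 3} : Finset ℕ)),
    (({2} : Finset ℕ), ({1} : Finset ℕ), ({0, 1, 2} : Finset ℕ)), (({2} : Finset ℕ), ({1} : Finset ℕ), ({0, 2, 3} : Finset ℕ)), (({2} : Finset ℕ), ({1} : Finset ℕ), ({1, 2, 3} : Finset ℕ)), (({2} : Finset ℕ), ({1} : Finset ℕ), ({0, 1, 2, 3} : Finset ℕ)),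
    (({2} : Finset ℕ), ({2} : Finset ℕ), ({0, 1, 2} : Finset ℕ)), (({2} : Finset ℕ), ({2} : Finset ℕ), ({0, 2, 3} : Finset ℕ)), (({2} : Finset ℕ), ({2} : Finset ℕ), ({1, 2, 3} : Finset ℕ)), (({2} : Finset ℕ), ({2} : Finset ℕ), ({0, 1, 2, 3} : Finset ℕ)),
    (({2} : Finset ℕ), ({0, 1, 2} : Finset ℕ), (∅ : Finset ℕ)), (({2} : Finset ℕ), ({0, 1, 2} : Finset ℕ), ({0} : Finset ℕ)), (({2} : Finset ℕ), ({0, 1, 2} : Finset ℕ), ({1} : Finset ℕ)), (({2} : Finset ℕ), ({0, 1, 2} : Finset ℕ), ({2} : Finset ℕ)),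
    (({2} : Finset ℕ), ({0, 2, 3} : Finset ℕ), (∅ : Finset ℕ)), (({2} : Finset ℕ), ({0, 2, 3} : Finset ℕ), ({0} : Finset ℕ)), (({2} : Finset ℕ), ({0, 2, 3} : Finset ℕ), ({1} : Finset ℕ)), (({2} : Finset ℕ), ({0, 2, 3} : Finset ℕ), ({2} : Finset ℕ)),
    (({2} : Finset ℕ), ({1, 2, 3} : Finset ℕ), (∅ : Finset ℕ)), (({2} : Finset ℕ), ({1, 2, 3} : Finset ℕ), ({0} : Finset ℕ)), (({2} : Finset ℕ), ({1, 2, 3} : Finset ℕ), ({1} : Finset ℕ)), (({2} : Finset ℕ), ({1, 2, 3} : Finset ℕ), ({2} : Finset ℕ)),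
    (({2} : Finset ℕ), ({0, 1, 2, 3} : Finset ℕ), (∅ : Finset ℕ)), (({2} : Finset ℕ), ({0, 1, 2, 3} : Finset ℕ), ({0} : Finset ℕ)), (({2} : Finset ℕ), ({0, 1, 2, 3} : Finset ℕ), ({1} : Finset ℕ)), (({2} : Finset ℕ), ({0, 1, 2, 3} : Finset ℕ), ({2} : Finset ℕ))]

/-- Outside-pivot triples with `κ = −1`. [this work] -/
def supBm : List (Finset ℕ × Finset ℕ × Finset ℕ) :=
  [((∅ : Finset ℕ), ({0, 1} : Finset ℕ), ({0, 2} : Finset ℕ)), ((∅ : Finset ℕ), ({0, 1} : Finset ℕ), ({1, 2} : Finset ℕ)), ((∅ : Finset ℕ), ({0, 2} : Finset ℕ), ({0, 1} : Finset ℕ)), ((∅ : Finset ℕ), ({0, 2} : Finset ℕ), ({1, 2} : Finset ℕ)),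
    ((∅ : Finset ℕ), ({0, 2} : Finset ℕ), ({3} : Finset ℕ)), ((∅ : Finset ℕ), ({0, 2} : Finset ℕ), ({0, 3} : Finset ℕ)), ((∅ : Finset ℕ), ({0, 2} : Finset ℕ), ({1, 3} : Finset ℕ)), ((∅ : Finset ℕ), ({0, 2} : Finset ℕ), ({0, 1, 3} : Finset ℕ)),
    ((∅ : Finset ℕ), ({0, 2} : Finset ℕ), ({2, 3} : Finset ℕ)), ((∅ : Finset ℕ), ({1, 2} : Finset ℕ), ({0, 1} : Finset ℕ)), ((∅ : Finset ℕ), ({1, 2} : Finset ℕ), ({0, 2} : Finset ℕ)), ((∅ : Finset ℕ), ({1, 2} : Finset ℕ), ({3} : Finset ℕ)),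
    ((∅ : Finset ℕ), ({1, 2} : Finset ℕ), ({0, 3} : Finset ℕ)), ((∅ : Finset ℕ), ({1, 2} : Finset ℕ), ({1, 3} : Finset ℕ)), ((∅ : Finset ℕ), ({1, 2} : Finset ℕ), ({0, 1, 3} : Finset ℕ)), ((∅ : Finset ℕ), ({1, 2} : Finset ℕ), ({2, 3} : Finset ℕ)),
    ((∅ : Finset ℕ), ({3} : Finset ℕ), ({0, 2} : Finset ℕ)), ((∅ : Finset ℕ), ({3} : Finset ℕ), ({1, 2} : Finset ℕ)), ((∅ : Finset ℕ), ({0, 3} : Finset ℕ), ({0, 2} : Finset ℕ)), ((∅ : Finset ℕ), ({0, 3} : Finset ℕ), ({1, 2} : Finset ℕ)),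
    ((∅ : Finset ℕ), ({1, 3} : Finset ℕ), ({0, 2} : Finset ℕ)), ((∅ : Finset ℕ), ({1, 3} : Finset ℕ), ({1, 2} : Finset ℕ)), ((∅ : Finset ℕ), ({0, 1, 3} : Finset ℕ), ({0, 2} : Finset ℕ)), ((∅ : Finset ℕ), ({0, 1, 3} : Finset ℕ), ({1, 2} : Finset ℕ)),
    ((∅ : Finset ℕ), ({2, 3} : Finset ℕ), ({0, 2} : Finset ℕ)), ((∅ : Finset ℕ), ({2, 3} : Finset ℕ), ({1, 2} : Finset ℕ)), (({0} : Finset ℕ), ({0, 1} : Finset ℕ), ({0, 2} : Finset ℕ)), (({0} : Finset ℕ), ({0, 1} : Finset ℕ), ({1, 2} : Finset ℕ)),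
    (({0} : Finset ℕ), ({0, 2} : Finset ℕ), ({0, 1} : Finset ℕ)), (({0} : Finset ℕ), ({0, 2} : Finset ℕ), ({1, 2} : Finset ℕ)), (({0} : Finset ℕ), ({0, 2} : Finset ℕ), ({3} : Finset ℕ)), (({0} : Finset ℕ), ({0, 2} : Finset ℕ), ({0, 3} : Finset ℕ)),
    (({0} : Finset ℕ), ({0, 2} : Finset ℕ), ({1, 3} : Finset ℕ)), (({0} : Finset ℕ), ({0, 2} : Finset ℕ), ({0, 1, 3} : Finset ℕ)), (({0} : Finset ℕ), ({0, 2} : Finset ℕ), ({2, 3} : Finset ℕ)), (({0} : Finset ℕ), ({1, 2} : Finset ℕ), ({0, 1} : Finset ℕ)),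
    (({0} : Finset ℕ), ({1, 2} : Finset ℕ), ({0, 2} : Finset ℕ)), (({0} : Finset ℕ), ({1, 2} : Finset ℕ), ({3} : Finset ℕ)), (({0} : Finset ℕ), ({1, 2} : Finset ℕ), ({0, 3} : Finset ℕ)), (({0} : Finset ℕ), ({1, 2} : Finset ℕ), ({1, 3} : Finset ℕ)),
    (({0} : Finset ℕ), ({1, 2} : Finset ℕ), ({0, 1, 3} : Finset ℕ)), (({0} : Finset ℕ), ({1, 2} : Finset ℕ), ({2, 3} : Finset ℕ)), (({0} : Finset ℕ), ({3} : Finset ℕ), ({0, 2} : Finset ℕ)), (({0} : Finset ℕ), ({3} : Finset ℕ), ({1, 2} : Finset ℕ)),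
    (({0} : Finset ℕ), ({0, 3} : Finset ℕ), ({0, 2} : Finset ℕ)), (({0} : Finset ℕ), ({0, 3} : Finset ℕ), ({1, 2} : Finset ℕ)), (({0} : Finset ℕ), ({1, 3} : Finset ℕ), ({0, 2} : Finset ℕ)), (({0} : Finset ℕ), ({1, 3} : Finset ℕ), ({1, 2} : Finset ℕ)),
    (({0} : Finset ℕ), ({0, 1, 3} : Finset ℕ), ({0, 2} : Finset ℕ)), (({0} : Finset ℕ), ({0, 1, 3} : Finset ℕ), ({1, 2} : Finset ℕ)), (({0} : Finset ℕ), ({2, 3} : Finset ℕ), ({0, 2} : Finset ℕ)), (({0} : Finset ℕ), ({2, 3} : Finset ℕ), ({1, 2} : Finset ℕ)),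
    (({1} : Finset ℕ), ({0, 1} : Finset ℕ), ({0, 2} : Finset ℕ)), (({1} : Finset ℕ), ({0, 1} : Finset ℕ), ({1, 2} : Finset ℕ)), (({1} : Finset ℕ), ({0, 2} : Finset ℕ), ({0, 1} : Finset ℕ)), (({1} : Finset ℕ), ({0, 2} : Finset ℕ), ({1, 2} : Finset ℕ)),
    (({1} : Finset ℕ), ({0, 2} : Finset ℕ), ({3} : Finset ℕ)), (({1} : Finset ℕ), ({0, 2} : Finset ℕ), ({0, 3} : Finset ℕ)), (({1} : Finset ℕ), ({0, 2} : Finset ℕ), ({1, 3} : Finset ℕ)), (({1} : Finset ℕ), ({0, 2} : Finset ℕ), ({0, 1, 3} : Finset ℕ)),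
    (({1} : Finset ℕ), ({0, 2} : Finset ℕ), ({2, 3} : Finset ℕ)), (({1} : Finset ℕ), ({1, 2} : Finset ℕ), ({0, 1} : Finset ℕ)), (({1} : Finset ℕ), ({1, 2} : Finset ℕ), ({0, 2} : Finset ℕ)), (({1} : Finset ℕ), ({1, 2} : Finset ℕ), ({3} : Finset ℕ)),
    (({1} : Finset ℕ), ({1, 2} : Finset ℕ), ({0, 3} : Finset ℕ)), (({1} : Finset ℕ), ({1, 2} : Finset ℕ), ({1, 3} : Finset ℕ)), (({1} : Finset ℕ), ({1, 2} : Finset ℕ), ({0, 1, 3} : Finset ℕ)), (({1} : Finset ℕ), ({1, 2} : Finset ℕ), ({2, 3} : Finset ℕ)),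
    (({1} : Finset ℕ), ({3} : Finset ℕ), ({0, 2} : Finset ℕ)), (({1} : Finset ℕ), ({3} : Finset ℕ), ({1, 2} : Finset ℕ)), (({1} : Finset ℕ), ({0, 3} : Finset ℕ), ({0, 2} : Finset ℕ)), (({1} : Finset ℕ), ({0, 3} : Finset ℕ), ({1, 2} : Finset ℕ)),
    (({1} : Finset ℕ), ({1, 3} : Finset ℕ), ({0, 2} : Finset ℕ)), (({1} : Finset ℕ), ({1, 3} : Finset ℕ), ({1, 2} : Finset ℕ)), (({1} : Finset ℕ), ({0, 1, 3} : Finset ℕ), ({0, 2} : Finset ℕ)), (({1} : Finset ℕ), ({0, 1, 3} : Finset ℕ), ({1, 2} : Finset ℕ)),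
    (({1} : Finset ℕ), ({2, 3} : Finset ℕ), ({0, 2} : Finset ℕ)), (({1} : Finset ℕ), ({2, 3} : Finset ℕ), ({1, 2} : Finset ℕ)), (({2} : Finset ℕ), ({0, 1} : Finset ℕ), ({0, 2} : Finset ℕ)), (({2} : Finset ℕ), ({0, 1} : Finset ℕ), ({1, 2} : Finset ℕ)),
    (({2} : Finset ℕ), ({0, 2} : Finset ℕ), ({0, 1} : Finset ℕ)), (({2} : Finset ℕ), ({0, 2} : Finset ℕ), ({1, 2} : Finset ℕ)), (({2} : Finset ℕ), ({0, 2} : Finset ℕ), ({3} : Finset ℕ)), (({2} : Finset ℕ), ({0, 2} : Finset ℕ), ({0, 3} : Finset ℕ)),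
    (({2} : Finset ℕ), ({0, 2} : Finset ℕ), ({1, 3} : Finset ℕ)), (({2} : Finset ℕ), ({0, 2} : Finset ℕ), ({0, 1, 3} : Finset ℕ)), (({2} : Finset ℕ), ({0, 2} : Finset ℕ), ({2, 3} : Finset ℕ)), (({2} : Finset ℕ), ({1, 2} : Finset ℕ), ({0, 1} : Finset ℕ)),
    (({2} : Finset ℕ), ({1, 2} : Finset ℕ), ({0, 2} : Finset ℕ)), (({2} : Finset ℕ), ({1, 2} : Finset ℕ), ({3} : Finset ℕ)), (({2} : Finset ℕ), ({1, 2} : Finset ℕ), ({0, 3} : Finset ℕ)), (({2} : Finset ℕ), ({1, 2} : Finset ℕ), ({1, 3} : Finset ℕ)),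
    (({2} : Finset ℕ), ({1, 2} : Finset ℕ), ({0, 1, 3} : Finset ℕ)), (({2} : Finset ℕ), ({1, 2} : Finset ℕ), ({2, 3} : Finset ℕ)), (({2} : Finset ℕ), ({3} : Finset ℕ), ({0, 2} : Finset ℕ)), (({2} : Finset ℕ), ({3} : Finset ℕ), ({1, 2} : Finset ℕ)),
    (({2} : Finset ℕ), ({0, 3} : Finset ℕ), ({0, 2} : Finset ℕ)), (({2} : Finset ℕ), ({0, 3} : Finset ℕ), ({1, 2} : Finset ℕ)), (({2} : Finset ℕ), ({1, 3} : Finset ℕ), ({0, 2} : Finset ℕ)), (({2} : Finset ℕ), ({1, 3} : Finset ℕ), ({1, 2} : Finset ℕ)),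
    (({2} : Finset ℕ), ({0, 1, 3} : Finset ℕ), ({0, 2} : Finset ℕ)), (({2} : Finset ℕ), ({0, 1, 3} : Finset ℕ), ({1, 2} : Finset ℕ)), (({2} : Finset ℕ), ({2, 3} : Finset ℕ), ({0, 2} : Finset ℕ)), (({2} : Finset ℕ), ({2, 3} : Finset ℕ), ({1, 2} : Finset ℕ))]

set_option maxRecDepth 100000 in
/-- The rainbow support (kernel enumeration of the 4096 triples). [this work] -/
theorem filter_rainbow_Sstar :
    Q4.filter (fun t => rainbow (Sstar t.1) (Sstar t.2.1) (Sstar t.2.2) ≠ 0) = supT.toFinset := by decide +kernel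

set_option maxRecDepth 100000 in
/-- Core pivots, `κ = +1`. [this work] -/
theorem filter_topPos_Sstar :
    Q4.filter (fun t => Sstar t.1 = top ∧ kappa (Sstar t.2.1) (Sstar t.2.2) = 1) = supAp.toFinset := by decide +kernel

set_option maxRecDepth 100000 in
/-- Core pivots, `κ = −1`. [this work] -/
theorem filter_topNeg_Sstar :
    Q4.filter (fun t => Sstar t.1 = top ∧ kappa (Sstar t.2.1) (Sstar t.2.2) = -1) = supAm.toFinset := by decide +kernel

set_option maxRecDepth 100000 in
/-- Outside pivots, `κ = +1`. [this work] -/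
theorem filter_botPos_Sstar :
    Q4.filter (fun t => Sstar t.1 = bot ∧ kappa (Sstar t.2.1) (Sstar t.2.2) = 1) = supBp.toFinset := by decide +kernel

set_option maxRecDepth 100000 in
/-- Outside pivots, `κ = −1`. [this work] -/
theorem filter_botNeg_Sstar :
    Q4.filter (fun t => Sstar t.1 = bot ∧ kappa (Sstar t.2.1) (Sstar t.2.2) = -1) = supBm.toFinset := by decide +kernel

/-! ### 3. Reduction of the three sums to their supports -/

/-- `rainbow` takes only the values `0, 1`. [this work] -/
theorem rainbow_zero_or_one {k : ℕ} (a b c : Lab k) : rainbow a b c = 0 ∨ rainbow a b c = 1 := by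
  unfold rainbow
  split
  · split_ifs <;> simp
  · simp

/-- `κ` takes only the values `−1, 0, 1`. [this work] -/
theorem kappa_trichotomy {k : ℕ} (a b : Lab k) : kappa a b = -1 ∨ kappa a b = 0 ∨ kappa a b = 1 := by
  unfold kappa
  split
  · simp
  · simp
  · split_ifs <;> simp
  · simp

/-- The rainbow sum over `S4` as a sum over triples. [this work] -/
theorem wRainbowSum_eq_sumQ (w : ℕ → ℕ → ℝ) (f : Finset ℕ → Lab 3) :
    wRainbowSum S4 w f = ∑ t ∈ Q4, tripleWeight S4 w t.1 t.2.1 t.2.2 * (rainbow (f t.1) (f t.2.1) (f t.2.2) : ℝ) := by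
  unfold wRainbowSum Q4
  simp only [Finset.sum_product]

/-- A side sum over `S4` as a sum over triples. [this work] -/
theorem wSideSum_eq_sumQ (w : ℕ → ℕ → ℝ) (f : Finset ℕ → Lab 3) (a : Lab 3) :
    wSideSum S4 w f a =
      ∑ t ∈ Q4, if f t.1 = a then tripleWeight S4 w t.1 t.2.1 t.2.2 * (3 * (kappa (f t.2.1) (f t.2.2) : ℝ)) else 0 := by
  unfold wSideSum Q4
  simp only [Finset.sum_product]

/-- `T(S*)` as a sum over its 36 rainbow triples. [this work] -/
theorem wRainbowSum_Sstar_support (w : ℕ → ℕ → ℝ) :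
    wRainbowSum S4 w Sstar = (supT.map fun t => tripleWeight S4 w t.1 t.2.1 t.2.2).sum := by
  rw [wRainbowSum_eq_sumQ]
  rw [← Finset.sum_filter_of_ne (p := fun t => rainbow (Sstar t.1) (Sstar t.2.1) (Sstar t.2.2) ≠ 0)
    (fun t _ h h0 => h (by rw [h0]; simp))]
  rw [filter_rainbow_Sstar, List.sum_toFinset _ (by decide)]
  congr 1
  refine List.map_congr_left fun t ht => ?_
  have ht' : t ∈ Q4.filter (fun t => rainbow (Sstar t.1) (Sstar t.2.1) (Sstar t.2.2) ≠ 0) := by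
    rw [filter_rainbow_Sstar, List.mem_toFinset]; exact ht
  rw [mem_filter] at ht'
  rcases rainbow_zero_or_one (Sstar t.1) (Sstar t.2.1) (Sstar t.2.2) with h0 | h1
  · exact absurd h0 ht'.2
  · rw [h1]; simp

/-- A side sum of `S*` as (plus-support) − (minus-support). [this work] -/
theorem wSideSum_Sstar_support (w : ℕ → ℕ → ℝ) (a : Lab 3) (Lp Lm : List (Finset ℕ × Finset ℕ × Finset ℕ))
    (hp : Q4.filter (fun t => Sstar t.1 = a ∧ kappa (Sstar t.2.1) (Sstar t.2.2) = 1) = Lp.toFinset) (hpn : Lp.Nodup)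
    (hm : Q4.filter (fun t => Sstar t.1 = a ∧ kappa (Sstar t.2.1) (Sstar t.2.2) = -1) = Lm.toFinset) (hmn : Lm.Nodup) :
    wSideSum S4 w Sstar a =
      3 * (Lp.map fun t => tripleWeight S4 w t.1 t.2.1 t.2.2).sum - 3 * (Lm.map fun t => tripleWeight S4 w t.1 t.2.1 t.2.2).sum := by
  rw [wSideSum_eq_sumQ]
  have split : ∀ t ∈ Q4, (if Sstar t.1 = a then tripleWeight S4 w t.1 t.2.1 t.2.2 * (3 * (kappa (Sstar t.2.1) (Sstar t.2.2) : ℝ)) else 0) =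
      (if (Sstar t.1 = a ∧ kappa (Sstar t.2.1) (Sstar t.2.2) = 1) then 3 * tripleWeight S4 w t.1 t.2.1 t.2.2 else 0) -
      (if (Sstar t.1 = a ∧ kappa (Sstar t.2.1) (Sstar t.2.2) = -1) then 3 * tripleWeight S4 w t.1 t.2.1 t.2.2 else 0) := by
    intro t _
    by_cases ht : Sstar t.1 = a
    · rcases kappa_trichotomy (Sstar t.2.1) (Sstar t.2.2) with h | h | h <;> simp [ht, h] <;> ring
    · simp [ht]
  rw [sum_congr rfl split, sum_sub_distrib, ← sum_filter, ← sum_filter, hp, hm, List.sum_toFinset _ hpn,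
    List.sum_toFinset _ hmn, List.sum_map_mul_left, List.sum_map_mul_left]

/-! ### 4. Closed forms -/

set_option maxRecDepth 200000 in
/-- `T(S*) = 6[a₀a₁(b₂+g₂)a₃ + (a₀b₁+b₀a₁+b₀b₁)b₂a₃ + b₀b₁b₂d₃]`. [this work] -/
theorem wRainbowSum_Sstar (w : ℕ → ℕ → ℝ) : wRainbowSum S4 w Sstar =
    6 * (w 0 1 * w 1 1 * (w 2 2 + w 2 3) * w 3 1 + (w 0 1 * w 1 2 + w 0 2 * w 1 1 + w 0 2 * w 1 2) * w 2 2 * w 3 1 +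
      w 0 2 * w 1 2 * w 2 2 * w 3 0) := by
  rw [wRainbowSum_Sstar_support]
  simp [supT, tripleWeight, S4]
  ring

set_option maxRecDepth 200000 in
/-- `Φ_A(S*) = T + 6(b₂+g₂)[b₃(a₀b₁+b₀a₁+b₀b₁) + a₃(b₀b₁ − a₀a₁)]`. [this work] -/
theorem wSideSumTop_Sstar (w : ℕ → ℕ → ℝ) : wSideSum S4 w Sstar top =
    6 * (w 0 1 * w 1 1 * (w 2 2 + w 2 3) * w 3 1 + (w 0 1 * w 1 2 + w 0 2 * w 1 1 + w 0 2 * w 1 2) * w 2 2 * w 3 1 +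
      w 0 2 * w 1 2 * w 2 2 * w 3 0) +
    6 * (w 2 2 + w 2 3) * (w 3 2 * (w 0 1 * w 1 2 + w 0 2 * w 1 1 + w 0 2 * w 1 2) + w 3 1 * (w 0 2 * w 1 2 - w 0 1 * w 1 1)) := by
  rw [wSideSum_Sstar_support w top supAp supAm filter_topPos_Sstar (by decide) filter_topNeg_Sstar (by decide)]
  simp [supAp, supAm, tripleWeight, S4]
  ring

set_option maxRecDepth 200000 in
/-- `Φ_B(S*) = T + 6(a₃+d₃)[a₂(a₀a₁+a₀b₁+b₀a₁) + b₂(a₀a₁ − b₀b₁)]`. [this work] -/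
theorem wSideSumBot_Sstar (w : ℕ → ℕ → ℝ) : wSideSum S4 w Sstar bot =
    6 * (w 0 1 * w 1 1 * (w 2 2 + w 2 3) * w 3 1 + (w 0 1 * w 1 2 + w 0 2 * w 1 1 + w 0 2 * w 1 2) * w 2 2 * w 3 1 +
      w 0 2 * w 1 2 * w 2 2 * w 3 0) +
    6 * (w 3 1 + w 3 0) * (w 2 1 * (w 0 1 * w 1 1 + w 0 1 * w 1 2 + w 0 2 * w 1 1) + w 2 2 * (w 0 1 * w 1 1 - w 0 2 * w 1 2)) := by
  rw [wSideSum_Sstar_support w bot supBp supBm filter_botPos_Sstar (by decide) filter_botNeg_Sstar (by decide)]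
  simp [supBp, supBm, tripleWeight, S4]
  ring

/-! ### 5. EXMAX for `S*` -/

/-- **THEOREM (EXMAX for `S*`, all nonnegative weights).**  For every coordinatewise nonnegative exchangeable weight, the rainbow sum of the
minimal mixed-payer system `S*` is paid by one side alone: `T ≤ Φ_A` or `T ≤ Φ_B` — the outside pays when `a₀a₁ ≥ b₀b₁`, the core pays when
`a₀a₁ ≤ b₀b₁`.  Via the block calculus this is `PivotDichotomy` on the pure fibre of every block composite `S*∘(c₀,…,c₃)`. [this work] -/
theorem exmax_Sstar (w : ℕ → ℕ → ℝ) (hw : ∀ j c, 0 ≤ w j c) :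
    wRainbowSum S4 w Sstar ≤ wSideSum S4 w Sstar top ∨ wRainbowSum S4 w Sstar ≤ wSideSum S4 w Sstar bot := by
  have h01 := hw 0 1; have h02 := hw 0 2; have h11 := hw 1 1; have h12 := hw 1 2
  have h21 := hw 2 1; have h22 := hw 2 2; have h23 := hw 2 3; have h30 := hw 3 0; have h31 := hw 3 1; have h32 := hw 3 2
  rcases le_total (w 0 2 * w 1 2) (w 0 1 * w 1 1) with h | h
  · -- a₀a₁ ≥ b₀b₁: the outside pays
    right
    rw [wRainbowSum_Sstar, wSideSumBot_Sstar]
    have hx : 0 ≤ w 2 1 * (w 0 1 * w 1 1 + w 0 1 * w 1 2 + w 0 2 * w 1 1) + w 2 2 * (w 0 1 * w 1 1 - w 0 2 * w 1 2) := by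
      have : 0 ≤ w 2 2 * (w 0 1 * w 1 1 - w 0 2 * w 1 2) := mul_nonneg h22 (by linarith)
      positivity
    nlinarith [mul_nonneg (add_nonneg h31 h30) hx]
  · -- a₀a₁ ≤ b₀b₁: the core pays
    left
    rw [wRainbowSum_Sstar, wSideSumTop_Sstar]
    have hx : 0 ≤ w 3 2 * (w 0 1 * w 1 2 + w 0 2 * w 1 1 + w 0 2 * w 1 2) + w 3 1 * (w 0 2 * w 1 2 - w 0 1 * w 1 1) := by
      have : 0 ≤ w 3 1 * (w 0 2 * w 1 2 - w 0 1 * w 1 1) := mul_nonneg h31 (by linarith)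
      positivity
    nlinarith [mul_nonneg (add_nonneg h22 h23) hx]

/-- **COROLLARY (pure fibre).**  `S*` itself satisfies the one-payer dichotomy: `T ≤ 3S_A ∨ T ≤ 3S_B` (the `S = {0,1,2,3}`, `f = S*` instance of
`PivotDichotomy 3`, from `exmax_Sstar` at the pure weight). [this work] -/
theorem pivotDichotomy_Sstar :
    rainbowSum S4 Sstar ≤ sideSum S4 Sstar top ∨ rainbowSum S4 Sstar ≤ sideSum S4 Sstar bot := by
  have h := exmax_Sstar (fun _ => pureWt) (fun j c => by unfold pureWt; split_ifs <;> norm_num)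
  rw [wRainbowSum_pure, wSideSum_pure, wSideSum_pure] at h
  rcases h with h | h
  · exact Or.inl (by exact_mod_cast h)
  · exact Or.inr (by exact_mod_cast h)

end SahiPivotFamily

end Summit.CriticalPhenomena.PercolationContinuityZ3.Theorems
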